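import Summits.QuantumFields.YangMills.Theorems.BalabanUVNodesK0Stub1FlatChartDTransposeLetter
import Summits.QuantumFields.YangMills.Theorems.BalabanUVNodesK0Stub1FlatHTransposeLetterAtRecord
import HarnessLib

/-!
# K0⁷ STUB 1 (`stub_prop8StepCoP13`), sub-target S4b ♭ road — **(β2) AT THE RECORD: THE IMPLICIT ♭ CHART `Dsel♭` WITH ALL THE LETTERS (β1)'s NEUMANN SOCKET CONSUMES**
# — the rows and right-inverse identity of the ♭-kernel `H`, the Socket's chart binders (`h55`, `ContDiffOn ℂ ω`), (49)♭∕(48)♭, the implicit-differentiation package `himp`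
# (`D(Dsel♭)(A′) = C♭′_Φ(1 − H∘D(Dsel♭)(A′))`, a transpose `Ct` of `C♭′_Φ`, its letter `θC = 32Θ♭(L)·M_ρ`) and the transposed-`H` letter `h₀` for EVERY transpose `Ht` — k-UNIFORM

Cell `pub-ymgap`, width seat `pub-ymgap-k0-s1-w4` g2 (CLAIM-3 ∕ INTENT-3, bus 2026-08-28T11:32Z; sequel of `…K0Stub1FlatChartDTransposeLetter` under the 400-line cap).
`--kind proof --supports stmt-QuantumFields-20541 --as helper`; count-neutral.  [15] = [Balaban1985Variational]; [B7] = [Balaban1985Averaging].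

WHAT IS PROVED (sorry-free; no definition; axioms standard; fibre `M_N(ℂ)`, `N ≥ 1`).
* ★★ `hHt_flat_T4` — `∃ Mh₀ R₀ h₀ ≥ 0` (BEFORE the family) such that at every admissible family of the record's tori, the (152) weights, EVERY ℂ-linear `H` with the ♭ kernel
  `(L^{j(t)}η)⁻¹·(flatH e_t)(b)`, every cyclic `τ` with a dualiser `ρ`, `BE = bondPair η d τ`, `B = Σ_t τ`, and EVERY `Ht` with `BE Z (H X) = B (Ht Z) X`:
  `(∀ b, w 3 b‖Z b‖ ≤ s′) → ∀ t, 1·‖Ht Z t‖ ≤ h₀·s′` — (β1)'s `hH` binder at `wB′ ≡ 1` (p620776 `h46t_unitWeight_of_adm22_T4` for the kernel form, which every such `Ht` has by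
  `adjointHt_apply_eq_kernel`).
* ★★★ `exists_chartDFlat_himp_T4` — `∃ Mh₀ R₀ B♭ ε♭ C_D♭ Θ♭′` (BEFORE the family: functions of `L` and k0-s1-w3's port constants) such that at every admissible family and EVERY `H` with
  the ♭ kernel: both (46) rows `B♭` (p621874); `D(chartLogFlat)(0)∘H = id` (FILE α); `∃ Dsel♭` with `h55` (`C_D♭`), `ContDiffOn ℂ ω` on the `ε♭`-ball, (49)♭ and (48)♭ there (FILE α
  `flatChartDSocket`), and for all fibre letters (`‖ρℓ‖ ≤ M_ρ‖ℓ‖`) and pairings the `himp` binder of (β1) with `θC = Θ♭′·M_ρ` (`himp_chartDFlat_P` at the record, `2Θ₀ = 32Θ♭(L)M_ρ`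
  at `d = 4`; the four windows of p627481 at `2ε♭` and FILE α's window are met by the choice of `ε♭`).
HONEST SCOPE.  Bookkeeping∕instantiation over landed letters BY NAME; the abstract Neumann step is k0-s1-w2's (β1); its window `2h₀θCε ≤ 1` is the consumer's (shrink `ε`);
nothing of [15]∕[B7] asserted beyond the engines; `stub_prop8StepCoP13` ∕ K0⁷ NOT closed; N07 NOT discharged; no summit statement is proved by this seat; counts unmoved
(28∕28 · 5∕27); one finite 𝕋⁴ programme at fixed ε — R4 closes the conditional finite-𝕋⁴ rung `BalabanLadder.UV` only, never the summit; the YM mass gap (Clay) is NOT proved by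
any of this; nothing continuum ∕ ℝ⁴ ∕ OS.  No `sorry`, no `def`, no `instance`, no `notation`.

References: [15] (27) p.282, (44)–(50) p.285, (55)–(57) p.286, (63)–(73) pp.287–289, (88)–(90) pp.291–292, (152) p.301, (157) p.302; [B7] Prop. 5 (157) p.42;
[Balaban1984PropagatorsII] Cor. 2.8 p.249; [Balaban1987RG1] (0.1) p.251.
-/

set_option autoImplicit false

noncomputable section

open scoped BigOperators Matrix.Norms.L2Operator Topology ContDiff
open NormedSpace Metric Set Filter

namespace Summit.QuantumFields.YangMills.Theorems.K0Stub1FlatChartDTransposeLetterAtRecord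

open Literature.MathematicalPhysics.QuantumFieldTheory.Balaban1983to89
open Summit.QuantumFields.YangMills.Theorems.K0Stub1FlatChartDTransposeLetter (himp_chartDFlat_P)

section Record

open Literature.MathematicalPhysics.QuantumFieldTheory.Balaban1983to89.T4Continuum (T4Family)
open B6SectADomainsV1 (Domains)
open B6SectAOperatorsV1 (BondIdx)
open B9Eq39Adjoint (bondPair)
open Summit.QuantumFields.YangMills.Theorems.FlatCubeOpsText (Adm22)
open Summit.QuantumFields.YangMills.Theorems.K0FlatCubeOpsTextP (IsLevWeight flatH)
open Summit.QuantumFields.YangMills.Theorems.Prop8ChartDoubleBar (chartLogFlat)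
open Summit.QuantumFields.YangMills.Theorems.K0Stub1FlatChartDImplicit (flatChartDSocket fderiv_chartLogFlat_zero_rescaledFlatH)
open Summit.QuantumFields.YangMills.Theorems.K0Stub1FlatHRescaledRowsAtRecord (rescaledRows_of_adm22_T4)
open Summit.QuantumFields.YangMills.Theorems.K0Stub1FlatHTransposeLetterAtRecord (h46t_unitWeight_of_adm22_T4 adjointHt_apply_eq_kernel)
open Summit.QuantumFields.YangMills.Theorems.K0Stub1PairingsAtExtensions (bondPair_PBond_eq_sum)
open Summit.QuantumFields.YangMills.BalabanUVNodes (N07ChartDOfRecord.exists_eps_chartD)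

/-- ★★ **(β1)'s `hH` BINDER FOR EVERY TRANSPOSE OF THE ♭-KERNEL `H`, k-UNIFORM** — for every `F : T4Family`, `N ≥ 1`: `∃ Mh₀ R₀ h₀ ≥ 0` such that at every admissible family of the
record's tori, the (152) weights, EVERY ℂ-linear `H` with the ♭ kernel `(L^{j(t)}η)⁻¹·(flatH e_t)(b)`, every cyclic `τ` with a dualiser `ρ`, the (27) pairing `BE = bondPair η d τ` and the
block pairing `B = Σ_t τ`, and EVERY `Ht` with `BE Z (H X) = B (Ht Z) X`: `(∀ b, w 3 b‖Z b‖ ≤ s′) → ∀ t, 1·‖Ht Z t‖ ≤ h₀·s′` (p620776 `h46t_unitWeight_of_adm22_T4` for the kernel form,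
which `Ht` has by `adjointHt_apply_eq_kernel`). [cite: Balaban1985Variational, (27) p.282, (45)-(46) p.285, (66) p.287, (152) p.301; Balaban1984PropagatorsII, Cor. 2.8 p.249; Balaban1987RG1, (0.1) p.251] -/
theorem hHt_flat_T4 (N : ℕ) [NeZero N] (F : T4Family) :
    ∃ (Mh₀ R₀ : ℕ) (h₀ : ℝ), 0 ≤ h₀ ∧
    ∀ (n K : ℕ) (_ : 1 ≤ K - n) (_ : K - n + 1 ≤ F.m + K) {Mh R a' : ℕ} (_ : Mh = F.L ^ a') (_ : Mh₀ ≤ Mh) (_ : R₀ ≤ R)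
      (_ : a' + 3 ≤ F.m + n) (D : Domains (F.P K)) (_ : D.k = K - n) (_ : Adm22 D R (F.L * Mh))
      {w : ℕ → PBond (F.P K) 0 → ℝ} (_ : IsLevWeight (F.P K) (K - n) D w)
      (H : (BondIdx D → Matrix (Fin N) (Fin N) ℂ) →ₗ[ℂ] (PBond (F.P K) 0 → Matrix (Fin N) (Fin N) ℂ))
      (_ : ∀ (X : BondIdx D → Matrix (Fin N) (Fin N) ℂ) (b : PBond (F.P K) 0), H X b =
        ∑ t, (((((F.P K).L : ℝ) ^ (t.1.1 : ℕ) * ((((F.P K).L : ℝ))⁻¹) ^ (K - n))⁻¹ * flatH (F.P K) (K - n) D (Pi.single t 1) b : ℝ) : ℂ) • X t)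
      (τ : Matrix (Fin N) (Fin N) ℂ →L[ℂ] ℂ) (ρ : (Matrix (Fin N) (Fin N) ℂ →L[ℂ] ℂ) →L[ℂ] Matrix (Fin N) (Fin N) ℂ)
      (_ : ∀ (ℓ' : Matrix (Fin N) (Fin N) ℂ →L[ℂ] ℂ) (X : Matrix (Fin N) (Fin N) ℂ), τ (ρ ℓ' * X) = ℓ' X)
      (_ : ∀ a b : Matrix (Fin N) (Fin N) ℂ, τ (a * b) = τ (b * a))
      (BE : (PBond (F.P K) 0 → Matrix (Fin N) (Fin N) ℂ) →L[ℂ] (PBond (F.P K) 0 → Matrix (Fin N) (Fin N) ℂ) →L[ℂ] ℂ)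
      (_ : ∀ Y δ : PBond (F.P K) 0 → Matrix (Fin N) (Fin N) ℂ, BE Y δ =
        bondPair ((((F.P K).L : ℝ))⁻¹ ^ (K - n)) (F.P K).d (τ : Matrix (Fin N) (Fin N) ℂ →ₗ[ℂ] ℂ) (fun μ x => Y ⟨x, μ⟩) (fun μ x => δ ⟨x, μ⟩))
      (B : (BondIdx D → Matrix (Fin N) (Fin N) ℂ) →L[ℂ] (BondIdx D → Matrix (Fin N) (Fin N) ℂ) →L[ℂ] ℂ)
      (_ : ∀ X X' : BondIdx D → Matrix (Fin N) (Fin N) ℂ, B X X' = ∑ t, τ (X t * X' t))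
      (Ht : (PBond (F.P K) 0 → Matrix (Fin N) (Fin N) ℂ) →L[ℂ] (BondIdx D → Matrix (Fin N) (Fin N) ℂ))
      (_ : ∀ Z X, BE Z (H X) = B (Ht Z) X)
      (Z : PBond (F.P K) 0 → Matrix (Fin N) (Fin N) ℂ) (s : ℝ) (_ : ∀ b, w 3 b * ‖Z b‖ ≤ s) (t : BondIdx D),
      (1 : ℝ) * ‖Ht Z t‖ ≤ h₀ * s := by
  classical
  obtain ⟨Mh₀, R₀, h₀, hh₀, h46⟩ := h46t_unitWeight_of_adm22_T4 F
  refine ⟨Mh₀, R₀, h₀, hh₀, ?_⟩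
  intro n K hk1 hk' Mh R a' hMha hMh hR hsize D hDk hAdm w hw H hH τ ρ hρ hτ BE hBE B hB Ht hHt Z s hZ t
  have hL0 : (0 : ℝ) < ((F.P K).L : ℝ) := by exact_mod_cast (F.P K).L_pos
  have hw3 : ∀ b, 0 ≤ w 3 b := fun b => by rw [hw 3 b]; positivity
  have hs : 0 ≤ s := (mul_nonneg (hw3 ⟨fun _ => 0, ⟨0, (F.P K).hd⟩⟩) (norm_nonneg _)).trans (hZ _)
  have hν : ∀ t' : BondIdx D, |(((F.P K).L : ℝ) ^ (t'.1.1 : ℕ) * ((((F.P K).L : ℝ))⁻¹) ^ (K - n))⁻¹| ≤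
      (((F.P K).L : ℝ) ^ (t'.1.1 : ℕ) * ((((F.P K).L : ℝ))⁻¹) ^ (K - n))⁻¹ := fun t' => by rw [abs_of_pos (by positivity)]
  have hBE' : ∀ Y δ : PBond (F.P K) 0 → Matrix (Fin N) (Fin N) ℂ, BE Y δ = ((((((F.P K).L : ℝ))⁻¹ ^ (K - n) : ℝ) : ℂ)) ^ (F.P K).d * ∑ b', τ (Y b' * δ b') :=
    fun Y δ => by rw [hBE]; exact bondPair_PBond_eq_sum _ (τ : Matrix (Fin N) (Fin N) ℂ →ₗ[ℂ] ℂ) Y δ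
  -- the kernel formula of THIS `Ht` (uniqueness of the transpose)
  have hker : ∀ (Z' : PBond (F.P K) 0 → Matrix (Fin N) (Fin N) ℂ) (t' : BondIdx D), Ht Z' t' =
      (((((((F.P K).L : ℝ))⁻¹ ^ (K - n) : ℝ) : ℂ) ^ (F.P K).d) *
        (((((F.P K).L : ℝ) ^ (t'.1.1 : ℕ) * ((((F.P K).L : ℝ))⁻¹) ^ (K - n))⁻¹ : ℝ) : ℂ)) •
        ∑ b', ((flatH (F.P K) (K - n) D (Pi.single t' 1) b' : ℝ) : ℂ) • Z' b' := by
    intro Z' t'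
    have h := adjointHt_apply_eq_kernel (ι := PBond (F.P K) 0) (κ := BondIdx D) τ ρ hρ hτ _ (BE := fun Y δ => BE Y δ) hBE' (B := fun X X' => B X X') hB
      (H := fun X => H X) (fun b' t'' => (((F.P K).L : ℝ) ^ (t''.1.1 : ℕ) * ((((F.P K).L : ℝ))⁻¹) ^ (K - n))⁻¹ * flatH (F.P K) (K - n) D (Pi.single t'' 1) b')
      (fun X b' => hH X b') (Ht := fun Z'' => Ht Z'') (fun Z'' X => hHt Z'' X) Z' t'
    rw [h, mul_smul]
    congr 1
    rw [Finset.smul_sum]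
    refine Finset.sum_congr rfl fun b' _ => ?_
    rw [Complex.ofReal_mul, mul_smul]
  exact h46 n K hk1 hk' hMha hMh hR hsize D hDk hAdm hw (𝔸 := Matrix (Fin N) (Fin N) ℂ)
    (fun t' => (((F.P K).L : ℝ) ^ (t'.1.1 : ℕ) * ((((F.P K).L : ℝ))⁻¹) ^ (K - n))⁻¹) hν (fun Z' => Ht Z') hker Z s hs hZ t


/-- ★★★ **THE IMPLICIT ♭ CHART WITH (β1)'s `himp` AT THE RECORD, k-UNIFORM** — for every `F : T4Family` and `N ≥ 1` there are thresholds `Mh₀ R₀` and constants `B♭ ≥ 0`,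
`ε♭ > 0`, `C_D♭ ≥ 0`, `Θ♭′ ≥ 0` (functions of `L` and k0-s1-w3's port constants, BEFORE the family) such that at every admissible nested family of the record's tori in the
standing range, for the (152) weights and EVERY ℂ-linear `H` with the ♭ kernel: (i) both (46) rows `B♭` of `H` (p621874); (ii) the right inverse `D(chartLogFlat)(0)(HX) = X` (FILE α);
(iii) `∃ Dsel♭` with the Socket's chart binders (`h55` with `C_D♭`, `ContDiffOn ℂ ω` on the `ε♭`-ball), (49)♭ and (48)♭ on the ball (FILE α `flatChartDSocket`), AND, for all fibre
letters (`τ`, `ρ`, `‖ρℓ‖ ≤ M_ρ‖ℓ‖`) and the (27)∕block pairings, (β1)'s `himp` binder with `θC = Θ♭′·M_ρ`: for sizes `≤ r < ε♭` of `A′`,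
`∃ C′ Ct, (∀ δ, D(Dsel♭)(A′)δ = C′(δ − H(D(Dsel♭)(A′)δ))) ∧ (Ct transposes C′) ∧ ∀ X s, (∀ t, 1·‖X t‖ ≤ s) → ∀ b, w 3 b‖Ct X b‖ ≤ (Θ♭′M_ρ)·r·s` (§1 at the record:
`2·Θ₀ = 32·Θ♭(L)·M_ρ` at `d = 4`).  Together with `hHt_flat_T4` this is everything (β1)'s `h73t_of_implicit_transposes` consumes at `Dfun := Dsel♭`, except its own Neumann window.
[cite: Balaban1985Variational, (27) p.282, (44)-(50) p.285, (55)-(57) p.286, (63)-(73) pp.287-289, (88)-(90) pp.291-292, (157) p.302; Balaban1985Averaging, Prop. 5 (157) p.42; Balaban1987RG1, (0.1) p.251] -/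
theorem exists_chartDFlat_himp_T4 (N : ℕ) [NeZero N] (F : T4Family) :
    ∃ (Mh₀ R₀ : ℕ) (Bf ε CD Θ : ℝ), 0 ≤ Bf ∧ 0 < ε ∧ 0 ≤ CD ∧ 0 ≤ Θ ∧
    ∀ (n K : ℕ) (_ : 1 ≤ K - n) (_ : K - n + 1 ≤ F.m + K) {Mh R a' : ℕ} (_ : Mh = F.L ^ a') (_ : Mh₀ ≤ Mh) (_ : R₀ ≤ R)
      (_ : a' + 3 ≤ F.m + n) (D : Domains (F.P K)) (_ : D.k = K - n) (_ : Adm22 D R (F.L * Mh))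
      (w : ℕ → PBond (F.P K) 0 → ℝ) (_ : IsLevWeight (F.P K) (K - n) D w)
      (H : (BondIdx D → Matrix (Fin N) (Fin N) ℂ) →ₗ[ℂ] (PBond (F.P K) 0 → Matrix (Fin N) (Fin N) ℂ))
      (_ : ∀ (X : BondIdx D → Matrix (Fin N) (Fin N) ℂ) (b : PBond (F.P K) 0), H X b =
        ∑ t, (((((F.P K).L : ℝ) ^ (t.1.1 : ℕ) * ((((F.P K).L : ℝ))⁻¹) ^ (K - n))⁻¹ * flatH (F.P K) (K - n) D (Pi.single t 1) b : ℝ) : ℂ) • X t),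
      (∀ (X : BondIdx D → Matrix (Fin N) (Fin N) ℂ) (t : ℝ), 0 ≤ t → (∀ c, ‖X c‖ ≤ t) → ∀ b, w 1 b * ‖H X b‖ ≤ Bf * t) ∧
      (∀ (X : BondIdx D → Matrix (Fin N) (Fin N) ℂ) (t : ℝ), 0 ≤ t → (∀ c, ‖X c‖ ≤ t) →
        ∀ (b : PBond (F.P K) 0) (ν : Fin (F.P K).d), w 2 b * ((F.P K).L : ℝ) ^ (K - n) * ‖H X ⟨b.src.shift ν, b.dir⟩ - H X b‖ ≤ Bf * t) ∧
      (∀ X, (fderiv ℂ (chartLogFlat ((((F.P K).L : ℝ)⁻¹) ^ (K - n)) D :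
          (PBond (F.P K) 0 → Matrix (Fin N) (Fin N) ℂ) → BondIdx D → Matrix (Fin N) (Fin N) ℂ) 0) (H X) = X) ∧
      ∃ Dsel : (PBond (F.P K) 0 → Matrix (Fin N) (Fin N) ℂ) → (BondIdx D → Matrix (Fin N) (Fin N) ℂ),
        (∀ A' : PBond (F.P K) 0 → Matrix (Fin N) (Fin N) ℂ, (∀ b, w 1 b * ‖A' b‖ < ε) →
          ∀ ρ' : ℝ, 0 ≤ ρ' → (∀ b, w 1 b * ‖A' b‖ ≤ ρ') → ∀ i : BondIdx D, ‖Dsel A' i‖ ≤ CD * ρ' ^ 2) ∧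
        ContDiffOn ℂ ω Dsel {Y : PBond (F.P K) 0 → Matrix (Fin N) (Fin N) ℂ | ∀ b, w 1 b * ‖Y b‖ < ε} ∧
        (∀ A' : PBond (F.P K) 0 → Matrix (Fin N) (Fin N) ℂ, (∀ b, w 1 b * ‖A' b‖ < ε) →
          chartLogFlat ((((F.P K).L : ℝ)⁻¹) ^ (K - n)) D (A' - H (Dsel A')) -
              (fderiv ℂ (chartLogFlat ((((F.P K).L : ℝ)⁻¹) ^ (K - n)) D :
                (PBond (F.P K) 0 → Matrix (Fin N) (Fin N) ℂ) → BondIdx D → Matrix (Fin N) (Fin N) ℂ) 0) (A' - H (Dsel A')) = Dsel A' ∧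
          chartLogFlat ((((F.P K).L : ℝ)⁻¹) ^ (K - n)) D (A' - H (Dsel A')) =
            (fderiv ℂ (chartLogFlat ((((F.P K).L : ℝ)⁻¹) ^ (K - n)) D :
              (PBond (F.P K) 0 → Matrix (Fin N) (Fin N) ℂ) → BondIdx D → Matrix (Fin N) (Fin N) ℂ) 0) A') ∧
        ∀ (τ : Matrix (Fin N) (Fin N) ℂ →L[ℂ] ℂ) (ρ : (Matrix (Fin N) (Fin N) ℂ →L[ℂ] ℂ) →L[ℂ] Matrix (Fin N) (Fin N) ℂ)
          (_ : ∀ (ℓ' : Matrix (Fin N) (Fin N) ℂ →L[ℂ] ℂ) (X : Matrix (Fin N) (Fin N) ℂ), τ (ρ ℓ' * X) = ℓ' X)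
          (_ : ∀ a b : Matrix (Fin N) (Fin N) ℂ, τ (a * b) = τ (b * a)) (_ : ∀ X : Matrix (Fin N) (Fin N) ℂ, ‖τ X‖ ≤ ‖X‖)
          {Mρ : ℝ} (_ : 0 ≤ Mρ) (_ : ∀ ℓ' : Matrix (Fin N) (Fin N) ℂ →L[ℂ] ℂ, ‖ρ ℓ'‖ ≤ Mρ * ‖ℓ'‖)
          (BE : (PBond (F.P K) 0 → Matrix (Fin N) (Fin N) ℂ) →L[ℂ] (PBond (F.P K) 0 → Matrix (Fin N) (Fin N) ℂ) →L[ℂ] ℂ)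
          (_ : ∀ Y δ : PBond (F.P K) 0 → Matrix (Fin N) (Fin N) ℂ, BE Y δ =
            bondPair ((((F.P K).L : ℝ))⁻¹ ^ (K - n)) (F.P K).d (τ : Matrix (Fin N) (Fin N) ℂ →ₗ[ℂ] ℂ) (fun μ x => Y ⟨x, μ⟩) (fun μ x => δ ⟨x, μ⟩))
          (B : (BondIdx D → Matrix (Fin N) (Fin N) ℂ) →L[ℂ] (BondIdx D → Matrix (Fin N) (Fin N) ℂ) →L[ℂ] ℂ)
          (_ : ∀ X X' : BondIdx D → Matrix (Fin N) (Fin N) ℂ, B X X' = ∑ t, τ (X t * X' t)),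
          ∀ (A' : PBond (F.P K) 0 → Matrix (Fin N) (Fin N) ℂ) (r : ℝ), (∀ b, w 1 b * ‖A' b‖ ≤ r) →
            (∀ (b : PBond (F.P K) 0) (ν : Fin (F.P K).d), w 2 b * ((F.P K).L : ℝ) ^ (K - n) * ‖A' ⟨b.src.shift ν, b.dir⟩ - A' b‖ ≤ r) → r < ε →
            ∃ (C' : (PBond (F.P K) 0 → Matrix (Fin N) (Fin N) ℂ) →L[ℂ] (BondIdx D → Matrix (Fin N) (Fin N) ℂ))
              (Ct : (BondIdx D → Matrix (Fin N) (Fin N) ℂ) →L[ℂ] (PBond (F.P K) 0 → Matrix (Fin N) (Fin N) ℂ)),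
              (∀ δ, fderiv ℂ Dsel A' δ = C' (δ - H (fderiv ℂ Dsel A' δ))) ∧
              (∀ X δ, BE (Ct X) δ = B X (C' δ)) ∧
              ∀ (X : BondIdx D → Matrix (Fin N) (Fin N) ℂ) (s : ℝ), (∀ t, (1 : ℝ) * ‖X t‖ ≤ s) →
                ∀ b, w 3 b * ‖Ct X b‖ ≤ (Θ * Mρ) * r * s := by
  classical
  obtain ⟨Mh₁, R₁, Bf, hBf, hrows⟩ := rescaledRows_of_adm22_T4 F
  have hL1 : (1 : ℝ) ≤ F.L := by exact_mod_cast F.hL.2.le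
  have hL12 : (12 : ℝ) ≤ F.L := by exact_mod_cast F.hL11
  have hL0 : (0 : ℝ) < (F.L : ℝ) := by linarith
  -- the k-uniform constants of the ♭ remainder (functions of `L`), made opaque after their positivity facts
  obtain ⟨ℓr, hℓr⟩ : ∃ ℓr : ℝ, ℓr = ((((4 : ℕ) + 2) * F.L : ℕ) : ℝ) := ⟨_, rfl⟩
  have hℓ1 : (1 : ℝ) ≤ ℓr := by
    rw [hℓr]; exact_mod_cast Nat.one_le_iff_ne_zero.mpr (Nat.mul_ne_zero (by omega) (by have := F.hL.2; omega))
  obtain ⟨Rs, hRs⟩ : ∃ Rs : ℝ, Rs = (60800 * ℓr ^ 2 * (F.L : ℝ))⁻¹ := ⟨_, rfl⟩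
  have hRs0 : 0 < Rs := by rw [hRs]; positivity
  obtain ⟨C₂, hC₂⟩ : ∃ C₂ : ℝ, C₂ = 64 * (F.L : ℝ) / Rs := ⟨_, rfl⟩
  have hC₂0 : 0 ≤ C₂ := by rw [hC₂]; exact div_nonneg (by positivity) hRs0.le
  obtain ⟨A3, hA3⟩ : ∃ A3 : ℝ, A3 = (2560 * ℓr / (400 * ℓr)⁻¹) * (2 * ((4 : ℕ) : ℝ)) / ((F.L : ℝ) ^ 2 * ((F.L : ℝ) ^ (4 : ℕ))⁻¹) := ⟨_, rfl⟩
  have hA3nn : 0 ≤ A3 := by rw [hA3]; positivity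
  have hdenΘ : 0 < 1 - 2 / (F.L : ℝ) - 1 / 12 := by
    have : 2 / (F.L : ℝ) ≤ 2 / 12 := div_le_div_of_nonneg_left (by norm_num) (by norm_num) hL12
    linarith
  obtain ⟨Θfl, hΘfl⟩ : ∃ Θfl : ℝ, Θfl = 16 * A3 * (F.L : ℝ) / (1 - 2 / (F.L : ℝ) - 1 / 12) := ⟨_, rfl⟩
  have hΘfl0 : 0 ≤ Θfl := by rw [hΘfl]; exact div_nonneg (by positivity) hdenΘ.le
  -- the radius: α's window and p627481's four windows at `2ε`
  obtain ⟨ε₁, hε₁, hq₁, h3ε₁⟩ := N07ChartDOfRecord.exists_eps_chartD hC₂0 hBf (by positivity : 0 < Rs / 4)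
  obtain ⟨A1, hA1⟩ : ∃ A1 : ℝ, A1 = 121600 * ℓr ^ 2 * (F.L : ℝ) := ⟨_, rfl⟩
  have hA1nn : 0 ≤ A1 := by rw [hA1]; positivity
  obtain ⟨W, hW⟩ : ∃ W : ℝ, W = 2 * A1 + 12 * 16 * (F.L : ℝ) * 2 * (A3 + 1) + 40 * (F.L : ℝ) := ⟨_, rfl⟩
  have hW0 : 0 < W := by rw [hW]; positivity
  obtain ⟨ε, hεdef⟩ : ∃ ε : ℝ, ε = min ε₁ (1 / (W + 1)) := ⟨_, rfl⟩
  have hεpos : 0 < ε := by rw [hεdef]; exact lt_min hε₁ (by positivity)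
  have hεε₁ : ε ≤ ε₁ := by rw [hεdef]; exact min_le_left _ _
  have hεW : ε * (W + 1) ≤ 1 := by
    have h : ε ≤ 1 / (W + 1) := by rw [hεdef]; exact min_le_right _ _
    rwa [le_div_iff₀ (by positivity)] at h
  -- the four windows at `2ε` and α's window, in the letters `ℓr, A3, C₂, Rs`
  have hA1' : A1 * (2 * ε) ≤ 1 := by
    have h1 : 2 * A1 ≤ W + 1 := by rw [hW]; nlinarith
    calc A1 * (2 * ε) = ε * (2 * A1) := by ring
      _ ≤ ε * (W + 1) := mul_le_mul_of_nonneg_left h1 hεpos.le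
      _ ≤ 1 := hεW
  have hA2' : 51200 * ℓr * (F.L : ℝ) * (2 * ε) ≤ 1 := by
    have h1 : 51200 * ℓr * (F.L : ℝ) ≤ A1 := by rw [hA1]; nlinarith
    calc 51200 * ℓr * (F.L : ℝ) * (2 * ε) ≤ A1 * (2 * ε) := mul_le_mul_of_nonneg_right h1 (by positivity)
      _ ≤ 1 := hA1'
  have hA3' : A3 * (16 * ((F.L : ℝ) * (2 * ε))) ≤ 1 / 12 := by
    have h1 : 12 * 16 * (F.L : ℝ) * 2 * (A3 + 1) ≤ W + 1 := by rw [hW]; nlinarith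
    have h2 : 12 * 16 * (F.L : ℝ) * 2 * (A3 + 1) * ε ≤ 1 :=
      calc 12 * 16 * (F.L : ℝ) * 2 * (A3 + 1) * ε = ε * (12 * 16 * (F.L : ℝ) * 2 * (A3 + 1)) := by ring
        _ ≤ ε * (W + 1) := mul_le_mul_of_nonneg_left h1 hεpos.le
        _ ≤ 1 := hεW
    have h3 : A3 * (16 * ((F.L : ℝ) * (2 * ε))) ≤ (A3 + 1) * (16 * ((F.L : ℝ) * (2 * ε))) :=
      mul_le_mul_of_nonneg_right (by linarith) (by positivity)
    have h4 : (A3 + 1) * (16 * ((F.L : ℝ) * (2 * ε))) = (12 * 16 * (F.L : ℝ) * 2 * (A3 + 1) * ε) / 12 := by ring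
    rw [h4] at h3
    linarith
  have hA4' : (F.L : ℝ) * (2 * ε) ≤ 1 / 20 := by
    have h1 : 40 * (F.L : ℝ) ≤ W + 1 := by rw [hW]; nlinarith
    have h2 : 40 * (F.L : ℝ) * ε ≤ 1 :=
      calc 40 * (F.L : ℝ) * ε = ε * (40 * (F.L : ℝ)) := by ring
        _ ≤ ε * (W + 1) := mul_le_mul_of_nonneg_left h1 hεpos.le
        _ ≤ 1 := hεW
    linarith
  have hq' : 9 * C₂ * Bf * ε < 1 := lt_of_le_of_lt (mul_le_mul_of_nonneg_left hεε₁ (by positivity)) hq₁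
  have h3ε' : 3 * ε ≤ Rs / 4 := by linarith
  -- rewrite the windows into the record's expanded letters
  subst hA1
  rw [hC₂, hRs, hℓr] at hq'
  rw [hRs, hℓr] at h3ε'
  rw [hℓr] at hA2'
  rw [hA3, hℓr] at hA3'
  rw [hℓr] at hA1'
  refine ⟨Mh₁, max R₁ (2 * F.L), Bf, ε, 4 * C₂, 32 * Θfl, hBf, hεpos, by positivity, by positivity, ?_⟩
  intro n K hk1 hk' Mh R a' hMha hMh hR hsize D hDk hAdm w hw H hH
  have hR₁ : R₁ ≤ R := le_trans (le_max_left _ _) hR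
  have hRL : 2 * (F.P K).L ≤ R := le_trans (le_max_right _ _) hR
  have hMh1 : 1 ≤ Mh := by rw [hMha]; exact Nat.one_le_pow _ _ (F.P K).L_pos
  have hM1 : 1 ≤ F.L * Mh := Nat.mul_pos (F.P K).L_pos (by omega)
  -- (i) the rows at `ν_t := (L^{j(t)}η)⁻¹`
  have hν : ∀ t : BondIdx D, |(((F.P K).L : ℝ) ^ (t.1.1 : ℕ) * ((((F.P K).L : ℝ))⁻¹) ^ (K - n))⁻¹| ≤
      (((F.P K).L : ℝ) ^ (t.1.1 : ℕ) * ((((F.P K).L : ℝ))⁻¹) ^ (K - n))⁻¹ := fun t => by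
    have : (0 : ℝ) < ((F.P K).L : ℝ) := by exact_mod_cast (F.P K).L_pos
    rw [abs_of_pos (by positivity)]
  obtain ⟨hHB, hHgrad⟩ := hrows n K hk1 hk' hMha hMh hR₁ hsize D hDk hAdm w hw (𝔸 := Matrix (Fin N) (Fin N) ℂ)
    (fun t => (((F.P K).L : ℝ) ^ (t.1.1 : ℕ) * ((((F.P K).L : ℝ))⁻¹) ^ (K - n))⁻¹) hν H hH
  -- (ii) the right inverse
  have hinv := fderiv_chartLogFlat_zero_rescaledFlatH (k := K - n) (D := D) H hH
  refine ⟨hHB, hHgrad, hinv, ?_⟩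
  -- (iii) the implicit chart at radius `ε` (FILE α)
  have hqα : 9 * (64 * ((F.P K).L : ℝ) / (60800 * ((((F.P K).d + 2) * (F.P K).L : ℕ) : ℝ) ^ 2 * ((F.P K).L : ℝ))⁻¹) * Bf * ε < 1 := by
    simpa only [T4Family.P_L, T4Family.P_d] using hq'
  have h3εα : 3 * ε ≤ (60800 * ((((F.P K).d + 2) * (F.P K).L : ℕ) : ℝ) ^ 2 * ((F.P K).L : ℝ))⁻¹ / 4 := by
    simpa only [T4Family.P_L, T4Family.P_d] using h3ε'
  obtain ⟨Dsel, -, -, h55, hcd, hfix⟩ := flatChartDSocket (N := N) (k := K - n) (D := D) hRL hM1 hDk hAdm hw H hBf hHB hinv (ε := ε) hqα h3εα hεpos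
  have h55' : ∀ A' : PBond (F.P K) 0 → Matrix (Fin N) (Fin N) ℂ, (∀ b, w 1 b * ‖A' b‖ < ε) →
      ∀ ρ' : ℝ, 0 ≤ ρ' → (∀ b, w 1 b * ‖A' b‖ ≤ ρ') → ∀ i : BondIdx D, ‖Dsel A' i‖ ≤ (4 * C₂) * ρ' ^ 2 := by
    intro A' hA' ρ' hρ' hA'ρ i
    rw [hC₂, hRs, hℓr]
    simpa only [T4Family.P_L, T4Family.P_d] using h55 A' hA' ρ' hρ' hA'ρ i
  refine ⟨Dsel, h55', hcd, hfix, ?_⟩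
  intro τ ρ hρ hτ hτ1 Mρ hMρ hρn BE hBE B hB A' r h0 h1 hr
  have hd : 4 ≤ (F.P K).d := by rw [T4Family.P_d]
  have hwin1 : 121600 * ((((F.P K).d + 2) * (F.P K).L : ℕ) : ℝ) ^ 2 * ((F.P K).L : ℝ) * (2 * ε) ≤ 1 := by
    simpa only [T4Family.P_L, T4Family.P_d] using hA1'
  have hwin2 : 51200 * ((((F.P K).d + 2) * (F.P K).L : ℕ) : ℝ) * ((F.P K).L : ℝ) * (2 * ε) ≤ 1 := by
    simpa only [T4Family.P_L, T4Family.P_d] using hA2'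
  have hwin3 : (2560 * ((((F.P K).d + 2) * (F.P K).L : ℕ) : ℝ) / (400 * ((((F.P K).d + 2) * (F.P K).L : ℕ) : ℝ))⁻¹) * (2 * ((F.P K).d : ℝ)) /
        (((F.P K).L : ℝ) ^ 2 * (((F.P K).L : ℝ) ^ (F.P K).d)⁻¹) * (16 * (((F.P K).L : ℝ) * (2 * ε))) ≤ 1 / 12 := by
    simpa only [T4Family.P_L, T4Family.P_d] using hA3'
  have hwin4 : ((F.P K).L : ℝ) * (2 * ε) ≤ 1 / 20 := by simpa only [T4Family.P_L] using hA4'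
  -- §1 at the record
  obtain ⟨C', Ct, himp1, himp2, hletter⟩ := himp_chartDFlat_P (N := N) hd (K - n) D hDk hAdm hRL hM1 hw τ ρ hρ hτ hτ1 hMρ hρn BE hBE B hB H hBf hHB hHgrad
    Dsel hεpos hqα h3εα h55 (fun A'' hA'' => (hfix A'' hA'').1) hwin1 hwin2 hwin3 hwin4 A' r h0 h1 hr
  refine ⟨C', Ct, himp1, himp2, fun X s hX b => (hletter X s hX b).trans (le_of_eq ?_)⟩
  -- the constant: `2·Θ₀ = 32·Θ♭·M_ρ` at `d = 4`
  have hη0 : 0 < (((F.P K).L : ℝ)⁻¹) ^ (K - n) := by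
    have : (0 : ℝ) < ((F.P K).L : ℝ) := by exact_mod_cast (F.P K).L_pos
    positivity
  rw [abs_of_pos hη0, hΘfl, hA3, hℓr]
  simp only [T4Family.P_L, T4Family.P_d]
  -- the common Θ♭(L) factor is generalised away; what is left is `2·((η⁴)⁻¹·M_ρ·T·(4·4·η⁴)) = 32·T·M_ρ`
  generalize (16 * (2560 * ((((4 : ℕ) + 2) * F.L : ℕ) : ℝ) / (400 * ((((4 : ℕ) + 2) * F.L : ℕ) : ℝ))⁻¹ * (2 * ((4 : ℕ) : ℝ)) /
      ((F.L : ℝ) ^ 2 * ((F.L : ℝ) ^ 4)⁻¹)) * (F.L : ℝ) / (1 - 2 / (F.L : ℝ) - 1 / 12)) = T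
  have hη4 : (((F.L : ℝ)⁻¹) ^ (K - n)) ^ 4 ≠ 0 := by positivity
  push_cast
  field_simp
  ring

end Record

end Summit.QuantumFields.YangMills.Theorems.K0Stub1FlatChartDTransposeLetterAtRecord

end
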